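import Summits.MatrixMultiplication.MatrixMultiplication.Theorems.FourierTwoFamiliesModPPrimeTwoFamiliesCapacityLift

/-!
# The self-converse lift as the length-2 code lift (support file, finite-core certificate)

Item `stmt-MatrixMultiplication-14308` (`FourierTwoFamiliesModP.PrimeTwoFamilies`, CKSU 2005 Conj. 4.7 with
prime cyclic hosts), line `Sketch` (capacity-gadget form), registered stub `selfConverseLift`.

A GADGET is a list of pairs `(P σ, Q σ)_{σ<r}` of finite subsets of an abelian group `K`, each DIRECT; letter
`σ` is STRONGLY SEPARATED towards `τ` when every cross difference `q - p` (`p ∈ P σ`, `q ∈ Q τ`) avoids every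
diagonal difference `q' - p'` (`p' ∈ P c`, `q' ∈ Q c`).  The tree's `CapacityLift.codeLift` lifts any
zero-error code `W ⊆ (Fin L → Fin r)` (every ordered pair of distinct words strongly separated in some
coordinate) to a family of product blocks satisfying clauses (W) and (X) of the simultaneous double product
property.

This file proves the registered stub `selfConverseLift` — the `r` blocks `(P σ ×ˢ P (π σ), Q σ ×ˢ Q (π σ))`
in `K × K` satisfy (W) and (X) as soon as a map `π` strongly separates every ordered pair of distinct letters
directly or after `π` — by REDUCTION TO THE FINITE CORE: the only combinatorial content beyond `codeLift` is
the certificate that the `r` graph words `![σ, π σ] : Fin 2 → Fin r` form a zero-error code of length `2`,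
the separating coordinate being `0` (direct separation) or `1` (separation after `π`)
(`graphWords_isCode`); everything else is transport along the embedding `a ↦ ![a.1, a.2]` of `K × K` into
`Fin 2 → K`, with every coordinate statement decided on `Fin 2` (`Fin.forall_fin_two`).  This is Lovász's
`Θ = √r` code for self-converse patterns in gadget form; Shannon's pentagon code `u ↦ 2u` over the letters
`({u}, {u, u+1})` of `ℤ/5` is an instance.

Design choice: no new definitions (the words and the embedding are written inline), so the file is a pure
proof; the direct two-coordinate proof of the same statement is `CapacityLift.selfConverseLift`.
-/

-- single-conjunct summit: the mandated namespace repeats `MatrixMultiplication` (summit = sub-problem).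
set_option linter.dupNamespace false

namespace Summit.MatrixMultiplication.MatrixMultiplication.Theorems.PrimeTwoFamilies.SelfConverseLiftK20

open Finset

/-- **FINITE-CORE CERTIFICATE.**  If `π` strongly separates every ordered pair of distinct letters either
directly or after `π`, then the graph words `![σ, π σ] : Fin 2 → Fin r` (`σ : Fin r`) form a zero-error code
in the sense of `CapacityLift.codeLift`: two distinct graph words are strongly separated in coordinate `0`
(direct case) or in coordinate `1` (after `π`). -/
theorem graphWords_isCode {K : Type*} [AddCommGroup K] {r : ℕ} (P Q : Fin r → Finset K)
    (π : Fin r → Fin r)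
    (hπ : ∀ σ τ : Fin r, σ ≠ τ →
      (∀ p ∈ P σ, ∀ q ∈ Q τ, ∀ c : Fin r, ∀ p' ∈ P c, ∀ q' ∈ Q c, q - p ≠ q' - p') ∨
      (∀ p ∈ P (π σ), ∀ q ∈ Q (π τ), ∀ c : Fin r, ∀ p' ∈ P c, ∀ q' ∈ Q c, q - p ≠ q' - p')) :
    ∀ i ∈ (univ : Finset (Fin r)).image (fun σ => (![σ, π σ] : Fin 2 → Fin r)),
    ∀ k ∈ (univ : Finset (Fin r)).image (fun σ => (![σ, π σ] : Fin 2 → Fin r)),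
      i ≠ k → ∃ t : Fin 2,
        ∀ p ∈ P (i t), ∀ q ∈ Q (k t), ∀ c : Fin r, ∀ p' ∈ P c, ∀ q' ∈ Q c, q - p ≠ q' - p' := by
  intro i hi k hk hik
  simp only [mem_image, mem_univ, true_and] at hi hk
  obtain ⟨σ, rfl⟩ := hi
  obtain ⟨τ, rfl⟩ := hk
  have hστ : σ ≠ τ := by
    rintro rfl
    exact hik rfl
  rcases hπ σ τ hστ with h | h
  · exact ⟨0, by simpa using h⟩
  · exact ⟨1, by simpa using h⟩

/-- Transport of membership: a point of the product block `F σ ×ˢ F τ` becomes, under `a ↦ ![a.1, a.2]`,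
a point of the `Fin 2`-indexed box over the word `![σ, τ]` (decided coordinatewise on `Fin 2`). -/
theorem vec_mem_piFinset {K : Type*} {r : ℕ} (F : Fin r → Finset K) (σ τ : Fin r) {a : K × K}
    (ha : a ∈ F σ ×ˢ F τ) :
    (![a.1, a.2] : Fin 2 → K) ∈ Fintype.piFinset (fun t => F ((![σ, τ] : Fin 2 → Fin r) t)) := by
  rw [Fintype.mem_piFinset, Fin.forall_fin_two]
  simpa only [mem_product, Matrix.cons_val_zero, Matrix.cons_val_one, Matrix.head_cons] using ha

/-- Transport of the SDPP relation `(a - a') + (b - b') = 0` from `K × K` to `Fin 2 → K` (checked on each of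
the two coordinates). -/
theorem vec_rel {K : Type*} [AddCommGroup K] {a a' b b' : K × K} (h : (a - a') + (b - b') = 0) :
    ((![a.1, a.2] : Fin 2 → K) - ![a'.1, a'.2]) + (![b.1, b.2] - ![b'.1, b'.2]) = 0 := by
  have h1 : (a.1 - a'.1) + (b.1 - b'.1) = 0 := by
    have := congrArg Prod.fst h; simpa using this
  have h2 : (a.2 - a'.2) + (b.2 - b'.2) = 0 := by
    have := congrArg Prod.snd h; simpa using this
  funext t
  revert t
  rw [Fin.forall_fin_two]
  exact ⟨by simpa using h1, by simpa using h2⟩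

/-- The embedding `a ↦ ![a.1, a.2]` of `K × K` into `Fin 2 → K` is injective (read off coordinates `0`
and `1`). -/
theorem vec_inj {K : Type*} {a a' : K × K} (h : (![a.1, a.2] : Fin 2 → K) = ![a'.1, a'.2]) : a = a' :=
  Prod.ext (by simpa using congrFun h 0) (by simpa using congrFun h 1)

/-- **SELF-CONVERSE LIFT** (registered stub `selfConverseLift` of crux `PrimeTwoFamilies`, line `Sketch`;
the `L = 2` code of graph words).  If every letter `(P c, Q c)` is direct (`hD`) and a map `π` on the letters
strongly separates every ordered pair of distinct letters either directly or after `π` (`hπ`), then the `r`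
blocks `(P σ ×ˢ P (π σ), Q σ ×ˢ Q (π σ))` in `K × K` satisfy clause (W) (first conjunct) and clause (X)
(second conjunct) of the simultaneous double product property.  Proof: `CapacityLift.codeLift` at `L = 2`
over the code of graph words certified by `graphWords_isCode`, transported along `a ↦ ![a.1, a.2]`. -/
theorem selfConverseLift {K : Type*} [AddCommGroup K] [DecidableEq K] {r : ℕ}
    (P Q : Fin r → Finset K)
    (hD : ∀ c : Fin r, ∀ x ∈ P c, ∀ x' ∈ P c, ∀ y ∈ Q c, ∀ y' ∈ Q c,
      (x - x') + (y - y') = 0 → x = x' ∧ y = y')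
    (π : Fin r → Fin r)
    (hπ : ∀ σ τ : Fin r, σ ≠ τ →
      (∀ p ∈ P σ, ∀ q ∈ Q τ, ∀ c : Fin r, ∀ p' ∈ P c, ∀ q' ∈ Q c, q - p ≠ q' - p') ∨
      (∀ p ∈ P (π σ), ∀ q ∈ Q (π τ), ∀ c : Fin r, ∀ p' ∈ P c, ∀ q' ∈ Q c, q - p ≠ q' - p')) :
    (∀ σ : Fin r, ∀ a ∈ P σ ×ˢ P (π σ), ∀ a' ∈ P σ ×ˢ P (π σ),
      ∀ b ∈ Q σ ×ˢ Q (π σ), ∀ b' ∈ Q σ ×ˢ Q (π σ),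
        (a - a') + (b - b') = 0 → a = a' ∧ b = b') ∧
    (∀ i j k : Fin r, ∀ a ∈ P i ×ˢ P (π i), ∀ a' ∈ P j ×ˢ P (π j),
      ∀ b ∈ Q j ×ˢ Q (π j), ∀ b' ∈ Q k ×ˢ Q (π k),
        (a - a') + (b - b') = 0 → i = k) := by
  -- the code lift at `L = 2` over the graph words `![σ, π σ]`
  obtain ⟨hW, hX⟩ := CapacityLift.codeLift P Q hD
    ((univ : Finset (Fin r)).image fun σ => (![σ, π σ] : Fin 2 → Fin r)) (graphWords_isCode P Q π hπ)
  have hw : ∀ σ : Fin r, (![σ, π σ] : Fin 2 → Fin r) ∈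
      (univ : Finset (Fin r)).image (fun σ => (![σ, π σ] : Fin 2 → Fin r)) :=
    fun σ => mem_image_of_mem _ (mem_univ σ)
  refine ⟨fun σ a ha a' ha' b hb b' hb' h => ?_, fun i j k a ha a' ha' b hb b' hb' h => ?_⟩
  · -- (W): the lifted block over the word `![σ, π σ]` is direct; pull back along the embedding
    obtain ⟨e1, e2⟩ := hW _ (hw σ) _ (vec_mem_piFinset P σ (π σ) ha) _ (vec_mem_piFinset P σ (π σ) ha')
      _ (vec_mem_piFinset Q σ (π σ) hb) _ (vec_mem_piFinset Q σ (π σ) hb') (vec_rel h)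
    exact ⟨vec_inj e1, vec_inj e2⟩
  · -- (X): the lifted family separates the words `![i, π i]` and `![k, π k]`; read off coordinate `0`
    have hik := hX _ (hw i) _ (hw j) _ (hw k) _ (vec_mem_piFinset P i (π i) ha)
      _ (vec_mem_piFinset P j (π j) ha') _ (vec_mem_piFinset Q j (π j) hb)
      _ (vec_mem_piFinset Q k (π k) hb') (vec_rel h)
    simpa using congrFun hik 0

end Summit.MatrixMultiplication.MatrixMultiplication.Theorems.PrimeTwoFamilies.SelfConverseLiftK20
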